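import Literature.NumberTheory.Automorphic.LeviConstantTermForms
import Literature.NumberTheory.Automorphic.IwasawaDecompositionAdelic
import Literature.NumberTheory.Automorphic.GLnMaximalCompactCompact
import Literature.NumberTheory.Automorphic.ConstantTermBlockGL
import Literature.NumberTheory.Automorphic.AdicCompletionCompact
import HarnessLib

/-!
# Decompositions of `GL_{k+l}(𝔸_K)` along the maximal parabolic `P_k = N M` used in
# Harish-Chandra's finiteness theorem
(Borel–Jacquet 1979, 4.3–4.4; Moeglin–Waldspurger 1995, I.1.4, I.2.1; Godement, Sém. Bourbaki 257)

Topic `NumberTheory/Automorphic`; group-theoretic and measure-theoretic support for the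
induction step of Harish-Chandra's finiteness theorem (`HarishChandraFinitenessGL`):

* `exists_unipotent_mul_leviGL_of_mem_standardParabolicGL` — **`P_k(R) = N_k(R) ⋊ M_k(R)`**: a block
  upper triangular invertible matrix is `(1 + Y) · diag(m₁, m₂)` with `Y` in the upper right
  block and `m₁ ∈ GL_k(R)`, `m₂ ∈ GL_l(R)` (any commutative ring `R`);
* `exists_unipotent_leviGL_maximalCompact_eq` — **`GL_{k+l}(𝔸_K) = N(𝔸) M(𝔸) K_∞ GL_{k+l}(𝒪̂_K)`**:
  every `g` is `u · diag(m₁, m₂) · (κ_∞, 1) · (1, κ_f)` (the adelic Iwasawa decomposition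
  `iwasawaDecomposition_gl_adelic_holds`, the Borel inside `P_k`, and the Levi decomposition);
* `exists_finset_coset_representatives` — for an open subgroup `U₀ ≤ GL_n(𝔸_K^∞)` there is a
  finite set of `κ_i ∈ GL_n(𝒪̂_K)` with `GL_n(𝒪̂_K) ⊆ ⋃ κ_i U₀` (compactness of `GL_n(𝒪̂_K)`);
* `blockCT_smul_measure`, `blockCT_eq_zero_of_blockCT_eq_zero` — the constant term along `P_k`
  scales with the Haar measure on the box, so its vanishing for one additive Haar measure gives it
  for all (uniqueness of Haar measure), whence the cusp condition
  (`cuspConditionGL_of_blockCT_eq_zero`).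

Everything here is proved; there are no new definitions.

## References

* A. Borel, H. Jacquet, *Automorphic forms and automorphic representations* (1979), 4.3–4.4
  [BorelJacquet1979].
* C. Moeglin, J.-L. Waldspurger, *Spectral decomposition and Eisenstein series* (1995), I.1.4,
  I.2.1 [MoeglinWaldspurger1995].
-/

noncomputable section

open scoped Matrix MatrixGroups Classical ENNReal Pointwise
open NumberField IsDedekindDomain NumberField.mixedEmbedding
open _root_.MeasureTheory _root_.MeasureTheory.Measure

namespace Literature.NumberTheory.Automorphic

/-! ### 1. The Levi decomposition of `P_k(R)` -/

section LeviDecomposition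

variable {R : Type*} [CommRing R] {k l : ℕ}

/-- `blockDiag'` through the reindexing algebra isomorphism. [folklore] -/
theorem blockDiag'_eq_reindexAlgEquiv (X : Matrix (Fin k) (Fin k) R) (Y : Matrix (Fin l) (Fin l) R) :
    HCLevi.blockDiag' R X Y = Matrix.reindexAlgEquiv R R finSumFinEquiv (Matrix.fromBlocks X 0 0 Y) :=
  rfl

/-- The lower left block of a matrix of `P_k` vanishes. [folklore] -/
theorem toBlocks₂₁_eq_zero_of_mem_standardParabolicGL {p : GL (Fin (k + l)) R}
    (hp : p ∈ standardParabolicGL R (maximalParabolicLabel (k + l) k)) :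
    (Matrix.reindex finSumFinEquiv.symm finSumFinEquiv.symm (p : Matrix (Fin (k + l)) (Fin (k + l)) R)).toBlocks₂₁ = 0 := by
  ext i j
  rw [Matrix.toBlocks₂₁, Matrix.of_apply, Matrix.reindex_apply, Matrix.submatrix_apply, Equiv.symm_symm,
    finSumFinEquiv_apply_right, finSumFinEquiv_apply_left, Matrix.zero_apply]
  refine (mem_standardParabolicGL_iff _ _).1 hp ?_
  rw [maximalParabolicLabel_of_lt (by simp), maximalParabolicLabel_of_le (by simp)]
  exact Fin.zero_lt_one

/-- A matrix supported on the upper right block (in the block coordinates `finSumFinEquiv`) is block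
nilpotent (cf. `reindex_fromBlocks_mem_blockNilpotent` of `MirabolicFourierStage` for `finBlockEquiv`).
[folklore] -/
theorem reindex_finSumFinEquiv_fromBlocks_mem_blockNilpotent (B : Matrix (Fin k) (Fin l) R) :
    Matrix.reindex finSumFinEquiv finSumFinEquiv (Matrix.fromBlocks (0 : Matrix (Fin k) (Fin k) R) B 0 (0 : Matrix (Fin l) (Fin l) R)) ∈
      blockNilpotent (k + l) k R := by
  intro a b hab
  rw [Matrix.reindex_apply, Matrix.submatrix_apply] at hab
  induction a using Fin.addCases with
  | left i =>
    induction b using Fin.addCases with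
    | left j => rw [finSumFinEquiv_symm_apply_castAdd, finSumFinEquiv_symm_apply_castAdd, Matrix.fromBlocks_apply₁₁] at hab; exact (hab rfl).elim
    | right j => exact ⟨by simp, by simp⟩
  | right i =>
    induction b using Fin.addCases with
    | left j => rw [finSumFinEquiv_symm_apply_natAdd, finSumFinEquiv_symm_apply_castAdd, Matrix.fromBlocks_apply₂₁] at hab; exact (hab rfl).elim
    | right j => rw [finSumFinEquiv_symm_apply_natAdd, finSumFinEquiv_symm_apply_natAdd, Matrix.fromBlocks_apply₂₂] at hab; exact (hab rfl).elim

/-- **The Levi decomposition `P_k(R) = N_k(R) M_k(R)`**: every `p ∈ P_k(R)` is `(1 + Y) · diag(m₁, m₂)`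
with `Y ∈ 𝔫_k(R)`, `m₁ ∈ GL_k(R)`, `m₂ ∈ GL_l(R)` (the diagonal blocks of `p`, invertible as
`det p = det m₁ · det m₂`, and `Y = B m₂⁻¹` for the upper right block `B`). Borel–Jacquet 1979, 4.4;
Moeglin–Waldspurger 1995, I.1.4. [cite: MoeglinWaldspurger1995, I.1.4] -/
theorem exists_unipotent_mul_leviGL_of_mem_standardParabolicGL {p : GL (Fin (k + l)) R}
    (hp : p ∈ standardParabolicGL R (maximalParabolicLabel (k + l) k)) :
    ∃ (Y : blockNilpotent (k + l) k R) (m₁ : GL (Fin k) R) (m₂ : GL (Fin l) R),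
      p = unipotentOfBlock (k + l) k R (Multiplicative.ofAdd Y) * leviGL R k l (m₁, m₂) := by
  set e : Fin k ⊕ Fin l ≃ Fin (k + l) := finSumFinEquiv with he
  set φ : Matrix (Fin k ⊕ Fin l) (Fin k ⊕ Fin l) R ≃ₐ[R] Matrix (Fin (k + l)) (Fin (k + l)) R :=
    Matrix.reindexAlgEquiv R R e with hφ
  set q : Matrix (Fin k ⊕ Fin l) (Fin k ⊕ Fin l) R :=
    Matrix.reindex e.symm e.symm (p : Matrix (Fin (k + l)) (Fin (k + l)) R) with hq
  have hpq : (p : Matrix (Fin (k + l)) (Fin (k + l)) R) = φ q := by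
    change _ = Matrix.reindex e e (Matrix.reindex e.symm e.symm (p : Matrix (Fin (k + l)) (Fin (k + l)) R))
    rw [← Matrix.reindex_symm, Equiv.apply_symm_apply]
  have hq₂₁ : q.toBlocks₂₁ = 0 := toBlocks₂₁_eq_zero_of_mem_standardParabolicGL hp
  have hqb : q = Matrix.fromBlocks q.toBlocks₁₁ q.toBlocks₁₂ 0 q.toBlocks₂₂ := by
    conv_lhs => rw [← Matrix.fromBlocks_toBlocks q]
    rw [hq₂₁]
  -- the diagonal blocks are invertible
  have hdet : (p : Matrix (Fin (k + l)) (Fin (k + l)) R).det = q.toBlocks₁₁.det * q.toBlocks₂₂.det := by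
    rw [hpq]
    change (Matrix.reindex e e q).det = _
    rw [Matrix.det_reindex_self]
    conv_lhs => rw [hqb]
    rw [Matrix.det_fromBlocks_zero₂₁]
  have hpu : IsUnit (p : Matrix (Fin (k + l)) (Fin (k + l)) R).det :=
    (Matrix.isUnit_iff_isUnit_det _).1 (Units.isUnit p)
  rw [hdet] at hpu
  obtain ⟨hA, hD⟩ := IsUnit.mul_iff.1 hpu
  set m₁ : GL (Fin k) R := ((Matrix.isUnit_iff_isUnit_det _).2 hA).unit with hm₁
  set m₂ : GL (Fin l) R := ((Matrix.isUnit_iff_isUnit_det _).2 hD).unit with hm₂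
  have hm₁c : (m₁ : Matrix (Fin k) (Fin k) R) = q.toBlocks₁₁ := IsUnit.unit_spec _
  have hm₂c : (m₂ : Matrix (Fin l) (Fin l) R) = q.toBlocks₂₂ := IsUnit.unit_spec _
  set Y' : Matrix (Fin k) (Fin l) R := q.toBlocks₁₂ * ((m₂⁻¹ : GL (Fin l) R) : Matrix (Fin l) (Fin l) R) with hY'
  refine ⟨⟨_, reindex_finSumFinEquiv_fromBlocks_mem_blockNilpotent Y'⟩, m₁, m₂, Units.ext ?_⟩
  rw [Units.val_mul, coe_unipotentOfBlock, toAdd_ofAdd, coe_leviGL]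
  change (p : Matrix (Fin (k + l)) (Fin (k + l)) R) =
    (1 + φ (Matrix.fromBlocks 0 Y' 0 0)) * φ (Matrix.fromBlocks (m₁ : Matrix (Fin k) (Fin k) R) 0 0 (m₂ : Matrix (Fin l) (Fin l) R))
  rw [← map_one φ, ← map_add, ← map_mul, ← Matrix.fromBlocks_one, Matrix.fromBlocks_add, Matrix.fromBlocks_multiply,
    hpq, hqb]
  congr 1
  simp only [add_zero, zero_add, Matrix.one_mul, Matrix.zero_mul, Matrix.mul_zero, hm₁c]
  rw [hY', Matrix.mul_assoc, Units.inv_mul, Matrix.mul_one, hm₂c]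

end LeviDecomposition

variable {K : Type} [Field K] [NumberField K] {k l : ℕ}

/-! ### 2. `GL_{k+l}(𝔸_K) = N(𝔸) M(𝔸) K_∞ GL_{k+l}(𝒪̂_K)` -/

section Iwasawa

/-- The Borel subgroup lies in `P_k` (the labelling of `P_k` is monotone; the lemma
`standardParabolicGL_id_le` of `GLnIwasawaIntegration`, not imported). [folklore] -/
theorem standardParabolicGL_id_le_maximal {R : Type*} [CommRing R] {n : ℕ} (k : ℕ) :
    standardParabolicGL R (id : Fin n → Fin n) ≤ standardParabolicGL R (maximalParabolicLabel n k) := by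
  intro g hg
  rw [mem_standardParabolicGL_iff] at hg ⊢
  intro i j hij
  exact hg (lt_of_not_ge fun hle => absurd (monotone_maximalParabolicLabel n k hle) (not_le.2 hij))

/-- **`GL_{k+l}(𝔸_K) = N_k(𝔸_K) · M_k(𝔸_K) · K_∞ · GL_{k+l}(𝒪̂_K)`**: every `g ∈ GL_{k+l}(𝔸_K)` is
`u · diag(m₁, m₂) · (κ_∞, 1) · (1, κ_f)` with `u ∈ N_k(𝔸_K)`, `κ_∞ ∈ K_∞`, `κ_f ∈ GL_{k+l}(𝒪̂_K)`
(adelic Iwasawa decomposition `GL = B · K`, `iwasawaDecomposition_gl_adelic_holds`; `B ≤ P_k`;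
`P_k = N_k M_k`; `K = K_∞ · GL(𝒪̂)`, `coe_standardMaximalCompactGL_eq_mul`). Borel–Jacquet 1979, 4.3;
Moeglin–Waldspurger 1995, I.1.4; Godement, Sém. Bourbaki 257, §1.2. [cite: MoeglinWaldspurger1995, I.1.4] -/
theorem exists_unipotent_leviGL_maximalCompact_eq (g : GL (Fin (k + l)) (AdeleRing (𝓞 K) K)) :
    ∃ (Y : blockNilpotent (k + l) k (AdeleRing (𝓞 K) K)) (m₁ : GL (Fin k) (AdeleRing (𝓞 K) K))
      (m₂ : GL (Fin l) (AdeleRing (𝓞 K) K)) (κ : Kinf (k + l) K) (κf : GL (Fin (k + l)) (FiniteAdeleRing (𝓞 K) K)),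
      κf ∈ glFiniteIntegralLevel (k + l) K ∧
      g = unipotentOfBlock (k + l) k (AdeleRing (𝓞 K) K) (Multiplicative.ofAdd Y) *
        leviGL (AdeleRing (𝓞 K) K) k l (m₁, m₂) *
          (GLn.ofInfinite (k + l) K (κ : GL (Fin (k + l)) (mixedSpace K)) * GLn.ofFinite (k + l) K κf) := by
  have h : (standardParabolicGL (AdeleRing (𝓞 K) K) (id : Fin (k + l) → Fin (k + l)) :
      Set (GL (Fin (k + l)) (AdeleRing (𝓞 K) K))) * (standardMaximalCompactGL (k + l) K : Set _) = Set.univ :=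
    iwasawaDecomposition_gl_adelic_holds (k + l) K
  have hg : g ∈ (standardParabolicGL (AdeleRing (𝓞 K) K) (id : Fin (k + l) → Fin (k + l)) :
      Set (GL (Fin (k + l)) (AdeleRing (𝓞 K) K))) * (standardMaximalCompactGL (k + l) K : Set _) := by
    rw [h]; exact Set.mem_univ g
  obtain ⟨b, hb, κ', hκ', rfl⟩ := Set.mem_mul.1 hg
  obtain ⟨Y, m₁, m₂, hbeq⟩ := exists_unipotent_mul_leviGL_of_mem_standardParabolicGL
    (standardParabolicGL_id_le_maximal k hb)
  have hκ'' : κ' ∈ (((Kinf (k + l) K).map (GLn.ofInfinite (k + l) K) : Subgroup (GL (Fin (k + l)) (AdeleRing (𝓞 K) K))) :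
      Set (GL (Fin (k + l)) (AdeleRing (𝓞 K) K))) * (glIntegralLevel (k + l) K : Set _) := by
    rw [← coe_standardMaximalCompactGL_eq_mul]; exact hκ'
  obtain ⟨x, hx, y, hy, rfl⟩ := Set.mem_mul.1 hκ''
  obtain ⟨κ, hκ, rfl⟩ := Subgroup.mem_map.1 hx
  have hy' := mem_glIntegralLevel_iff.1 hy
  have hyeq : y = GLn.ofFinite (k + l) K (GLn.sndHom (k + l) K y) :=
    GLn.ext_of_fstHom_of_sndHom (by rw [GLn.fstHom_ofFinite, hy'.2]) (by rw [GLn.sndHom_ofFinite])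
  exact ⟨Y, m₁, m₂, ⟨κ, hκ⟩, GLn.sndHom (k + l) K y, hy'.1, by rw [hbeq, ← hyeq]⟩

end Iwasawa

/-! ### 3. Finitely many cosets of an open subgroup in `GL_n(𝒪̂_K)` -/

section Cosets

/-- **An open subgroup of `GL_n(𝔸_K^∞)` has finitely many cosets meeting `GL_n(𝒪̂_K)`**: there is
a finite set of `κ_i ∈ GL_n(𝒪̂_K)` with `GL_n(𝒪̂_K) ⊆ ⋃_i κ_i U₀` (the translates `κ U₀` form an
open cover of the compact `GL_n(𝒪̂_K)`). Borel–Jacquet 1979, 4.3 (finiteness of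
`G(K)\G(𝔸)/U`-type double cosets is not needed; only compactness of `GL_n(𝒪̂_K)`). [folklore] -/
theorem exists_finset_coset_representatives {n : ℕ} {U₀ : Subgroup (GL (Fin n) (FiniteAdeleRing (𝓞 K) K))}
    (hU₀ : IsOpen (U₀ : Set (GL (Fin n) (FiniteAdeleRing (𝓞 K) K)))) :
    ∃ s : Finset (GL (Fin n) (FiniteAdeleRing (𝓞 K) K)),
      (∀ κ ∈ s, κ ∈ glFiniteIntegralLevel n K) ∧
      ∀ κf ∈ glFiniteIntegralLevel n K, ∃ κ ∈ s, ∃ u ∈ U₀, κf = κ * u := by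
  have hc : IsCompact (glFiniteIntegralLevel n K : Set (GL (Fin n) (FiniteAdeleRing (𝓞 K) K))) :=
    isCompact_glFiniteIntegralLevel_holds n K
  set V : glFiniteIntegralLevel n K → Set (GL (Fin n) (FiniteAdeleRing (𝓞 K) K)) := fun κ =>
    (fun u => (κ : GL (Fin n) (FiniteAdeleRing (𝓞 K) K)) * u) '' (U₀ : Set _) with hV
  have hVo : ∀ κ, IsOpen (V κ) := fun κ => isOpenMap_mul_left (κ : GL (Fin n) (FiniteAdeleRing (𝓞 K) K)) _ hU₀
  have hcover : (glFiniteIntegralLevel n K : Set (GL (Fin n) (FiniteAdeleRing (𝓞 K) K))) ⊆ ⋃ κ, V κ := by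
    intro κf hκf
    exact Set.mem_iUnion.2 ⟨⟨κf, hκf⟩, 1, U₀.one_mem, mul_one _⟩
  obtain ⟨t, ht⟩ := hc.elim_finite_subcover V hVo hcover
  refine ⟨t.image (fun κ : glFiniteIntegralLevel n K => (κ : GL (Fin n) (FiniteAdeleRing (𝓞 K) K))), ?_, ?_⟩
  · intro κ hκ
    obtain ⟨κ', -, hκ'⟩ := Finset.mem_image.1 hκ
    rw [← hκ']
    exact κ'.2
  · intro κf hκf
    have hκf' := ht hκf
    rw [Set.mem_iUnion₂] at hκf'
    obtain ⟨κ, hκt, hκV⟩ := hκf'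
    obtain ⟨u, hu, hu'⟩ := hκV
    exact ⟨κ, Finset.mem_image.2 ⟨κ, hκt, rfl⟩, u, hu, hu'.symm⟩

end Cosets

/-! ### 4. The constant term and the choice of the Haar measure on the box -/

section Haar

variable [MeasurableSpace (AdeleRing (𝓞 K) K)] [BorelSpace (AdeleRing (𝓞 K) K)]

omit [BorelSpace (AdeleRing (𝓞 K) K)] in
/-- The constant term scales with the measure on the box. [folklore] -/
theorem blockCT_smul_measure {n c : ℕ} (hc : c ≤ n) (k : ℕ) (ν : Measure (BlockIdx c k → AdeleRing (𝓞 K) K))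
    (a : ℝ≥0∞) (φ : GL (Fin n) (AdeleRing (𝓞 K) K) → ℂ) (y : GL (Fin n) (AdeleRing (𝓞 K) K)) :
    blockCT hc k (a • ν) φ y = a.toReal • blockCT hc k ν φ y := by
  rw [blockCT_apply, blockCT_apply, Measure.restrict_smul, integral_smul_measure]

/-- **The vanishing of the constant term does not depend on the additive Haar measure on the box**
(two additive Haar measures on `𝔫_k(𝔸_K)` are proportional, `addHaarMeasure_unique`). [folklore] -/
theorem blockCT_eq_zero_of_blockCT_eq_zero {n k : ℕ} {φ : GL (Fin n) (AdeleRing (𝓞 K) K) → ℂ}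
    (ν ν' : Measure (BlockIdx n k → AdeleRing (𝓞 K) K)) [ν.IsAddHaarMeasure] [ν'.IsAddHaarMeasure]
    (h : ∀ y, blockCT (le_refl n) k ν φ y = 0) (y : GL (Fin n) (AdeleRing (𝓞 K) K)) :
    blockCT (le_refl n) k ν' φ y = 0 := by
  haveI := t2Space_adeleRing K
  haveI := secondCountableTopology_adeleRing K
  haveI := locallyCompactSpace_adeleRing' K
  haveI : BorelSpace (BlockIdx n k → AdeleRing (𝓞 K) K) := Pi.borelSpace
  obtain ⟨K₀⟩ : Nonempty (TopologicalSpace.PositiveCompacts (BlockIdx n k → AdeleRing (𝓞 K) K)) :=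
    TopologicalSpace.PositiveCompacts.nonempty'
  have hν := addHaarMeasure_unique ν K₀
  have hν' := addHaarMeasure_unique ν' K₀
  have hK₀0 : ν K₀ ≠ 0 := (measure_pos_of_nonempty_interior ν K₀.interior_nonempty).ne'
  have hK₀t : ν K₀ ≠ ∞ := K₀.isCompact.measure_lt_top.ne
  have h0 : blockCT (le_refl n) k (addHaarMeasure K₀) φ y = 0 := by
    have hy := h y
    rw [hν, blockCT_smul_measure] at hy
    exact (smul_eq_zero.1 hy).resolve_left (ENNReal.toReal_ne_zero.2 ⟨hK₀0, hK₀t⟩)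
  rw [hν', blockCT_smul_measure, h0, smul_zero]

/-- **The cusp condition along `P_k` from the vanishing of `φ_P` for one additive Haar measure on
the box** (`cuspConditionGL_of_forall_blockCT_eq_zero`). Borel–Jacquet 1979, 4.4.
[cite: BorelJacquet1979, 4.4] -/
theorem cuspConditionGL_of_blockCT_eq_zero {n k : ℕ} {φ : GL (Fin n) (AdeleRing (𝓞 K) K) → ℂ}
    (hφc : Continuous φ) (hleft : IsLeftInvariant (AdelicGroupData.gl n K) φ)
    (ν : Measure (BlockIdx n k → AdeleRing (𝓞 K) K)) [ν.IsAddHaarMeasure]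
    (h : ∀ y, blockCT (le_refl n) k ν φ y = 0) : CuspConditionGL n K φ k :=
  cuspConditionGL_of_forall_blockCT_eq_zero hφc hleft fun ν' hν' y => by
    haveI := hν'
    exact blockCT_eq_zero_of_blockCT_eq_zero ν ν' h y

end Haar

end Literature.NumberTheory.Automorphic
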